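import Literature.AlgebraicGeometry.ModuliOfAbelianVarieties.SiegelFineModuliSchemeLevelKernelActionFree
import Literature.AlgebraicGeometry.RelativeSpec.GeometricQuotientFreeEtale
import Literature.AlgebraicGeometry.RelativeSpec.FreeActionOfPoints
import Literature.AlgebraicGeometry.Morphisms.SmoothOfFlatSurjectiveSmoothSource
import HarnessLib

/-!
# The level-descent quotient `M → M/Δ` is finite étale, and `M/Δ` is smooth over `ℚ`
# ([MumfordFogartyKirwan1994] Ch. 7 §3, remark after Thm. 7.9 (p. 139) and Lemma 7.11 (p. 140))

Topic `AlgebraicGeometry/ModuliOfAbelianVarieties`; namespace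
`Literature.AlgebraicGeometry.ModuliOfAbelianVarieties.SiegelFineModuliScheme`.
THEOREMS ONLY (no definition, no named fact, no instance, no notation, no `sorry`).
Cell `hodgecm-mathlib` (D-0151), F-DAG leaf F-10 (10c) «the clauses of (F) descend to the level-descended carrier
`Q = M/Δ`» (B-plan1 (g16) 07:43:13Z / 07:45:41Z; author B-p06 (g12); census
`B-provers/B-p06/g12/CENSUS-10c-LevelQuotientClauses.B-p06g12.md`).  Count-neutral capital: HC_CM is proved only modulo
the 7 printed citations until rung 0 closes — nothing here is about HC.

[MumfordFogartyKirwan1994] Ch. 7 §3 (p. 139): «using the so-called "lemma of Serre" …, it can be shown that Theorem 7.9 is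
true even if `n ≥ 3`»; Lemma 7.11 (p. 140): «`A_{g,d,nk} → A_{g,d,n}` is a finite étale Galois covering» — the group
`Γ = ker(level nk → level n)` acts FREELY (Serre) on the fine moduli scheme `A_{g,d,nk}`, so the geometric quotient
`A_{g,d,nk} → A_{g,d,nk}/Γ = A_{g,d,n}` is a finite étale surjection, and smoothness of `A_{g,d,nk}` over the ground
field descends to the quotient ([Grothendieck1967] IV 17.7.7: smoothness descends along a flat surjection of the source).

Here, for a fine moduli carrier `𝓜 : SiegelFineModuliScheme g N δ` (★ `SiegelFineModuliScheme`), `N = N₀ d`, `3 ≤ N₀`,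
the finite action `act : Δ →* Aut M` of `Δ = red(K_δ(N₀))` through the twist operators (the data and clauses of ★
`exists_levelKernel_finite_action` / ★ `exists_levelGroupQuotient_action`, passed as binders exactly as those theorems
export them) and ANY `Δ`-invariant `ℚ`-morphism `p : M → Q` with the action `ρ` viewed over `p.left`:
* **`levelGroupQuotient_free`** — the action is FREE ON THE AFFINE CHARTS of `p` (for `x ≠ 1` the `x·b − b` generate the
  unit ideal of `Γ(M, p⁻¹U)`): ★ `levelKernel_action_comp_ne` (Serre's lemma: no `x ≠ 1` fixes a geometric point) fed
  to ★ `ActionOver.free_of_forall_comp_aut_ne` — the `hfree` currency of the descent files ★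
  `exists_triple_desc_of_free_base_quotient` (10a), `GeometricQuotientFreeEquivariantDescent`, ….
* **`etale_levelGroupQuotient`** — if `p` is a geometric quotient by `ρ` (Mumford's (1), (2): ★
  `ActionOver.IsGeometricQuotient`, the clause of ★ `exists_levelGroupQuotient_action`) and finite, then `p.left` is
  ÉTALE and SURJECTIVE (★ `IsGeometricQuotient.etale_of_free`): MFK Lemma 7.11.
* **`smooth_levelGroupQuotient_hom`** — … and then `Q → Spec ℚ` is SMOOTH as soon as `M → Spec ℚ` is (★
  `Morphisms.smooth_of_flat_surjective_of_smooth_comp_of_hom_spec`, EGA IV 17.7.7 over a field of characteristic `0`):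
  the clause `Smooth 𝓠.M.hom` of ★ `lan2013_siegelFineModuliScheme` for the level-descended carrier (consumer: the F-10
  package `SiegelFineModuliScheme.exists_levelDescent`).
The quasi-projectivity clauses are NOT here: `IsQuasiProjectiveOver Q` is a clause of ★ `exists_levelGroupQuotient_action`
([MumfordAV1970] §7 Remark p. 69), and the universal-total-space clause belongs to the construction of the descended
universal triple ((10a)-on-`Q`).

## References
* [MumfordFogartyKirwan1994] D. Mumford, J. Fogarty, F. Kirwan, *Geometric Invariant Theory*, 3rd ed. (1994), Ch. 7 §3,
  remark after Theorem 7.9 (p. 139), Lemma 7.11 (p. 140).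
* [Grothendieck1967] A. Grothendieck, *EGA IV₄* (1967), Prop. 17.7.7.
* [SGA1] A. Grothendieck, *SGA 1*, Exp. V, Prop. 2.6, Cor. 2.4.
* [Deligne1971TravauxShimura] P. Deligne, *Travaux de Shimura* (1971), 4.16 p. 150.
-/

noncomputable section

open CategoryTheory CategoryTheory.Limits AlgebraicGeometry

namespace Literature.AlgebraicGeometry.ModuliOfAbelianVarieties

open Literature.AlgebraicGeometry.Motives (SchemeOver)
open Literature.AlgebraicGeometry.AbelianSchemes (PolarizedAbelianSchemeWithLevel)
open Literature.AlgebraicGeometry.RelativeSpec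
open Literature.NumberTheory.Adeles NumberField IsDedekindDomain

namespace SiegelFineModuliScheme

variable {g N : ℕ} {δ : Fin g → ℕ} (𝓜 : SiegelFineModuliScheme g N δ) [IsCommMonObj 𝓜.univ.A.X] [NeZero N]

/-- **THE LEVEL-DESCENT ACTION IS FREE ON THE AFFINE CHARTS** ([MumfordFogartyKirwan1994] Ch. 7 §3, remark after Thm. 7.9
(p. 139): `Γ` acts freely by the lemma of Serre).  For the finite twist action `act : Δ →* Aut M` (clauses of ★
`exists_levelKernel_finite_action`), `N = N₀ d`, `3 ≤ N₀`, `M` locally of finite type over `ℚ`, and any `ℚ`-morphism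
`p : M → Q` with affine underlying map carrying the same action `ρ` over `p.left` (`(ρ.aut x).hom = (act x).hom.left`):
for every affine open `U ⊆ Q` and every `x ≠ 1` in `Δ`, the elements `x·b − b`, `b ∈ Γ(M, p⁻¹U)`, generate the unit
ideal — the hypothesis `hfree` of ★ `IsGeometricQuotient.etale_of_free` / `isFinite_of_free` / `flat_of_free` and of the
descent ★ `exists_triple_desc_of_free_base_quotient`.  Proof: ★ `levelKernel_action_comp_ne` (no `x ≠ 1` fixes a geometric
point of `M`) is verbatim the hypothesis of ★ `ActionOver.free_of_forall_comp_aut_ne`.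
[cite: MumfordFogartyKirwan1994, Ch. 7 §3, remark after Theorem 7.9 (p. 139) and Lemma 7.11 (p. 140)]
[cite: SGA1, Exp. V Prop. 2.6 (i), Déf. 2.7] -/
theorem levelGroupQuotient_free [LocallyOfFiniteType 𝓜.M.hom] (hδ : IsPolarizationType δ) (hg : 0 < g)
    {N₀ d : ℕ} [NeZero N₀] (hd : N = N₀ * d) (hN₀ : 3 ≤ N₀)
    (red : principalLevelSubgroup δ 1 →* GL (Fin g ⊕ Fin g) (ZMod N))
    (Δ : Subgroup (GL (Fin g ⊕ Fin g) (ZMod N))) (act : Δ →* Aut 𝓜.M)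
    (hred : ∀ (k : principalLevelSubgroup δ 1) (i j : Fin g ⊕ Fin g)
      (h : (((k : gspFinAdelic δ) : GL (Fin g ⊕ Fin g) finAdeleQ) :
        Matrix (Fin g ⊕ Fin g) (Fin g ⊕ Fin g) finAdeleQ) i j ∈ FiniteAdeleRing.integralAdeles (𝓞 ℚ) ℚ),
      ((red k : GL (Fin g ⊕ Fin g) (ZMod N)) : Matrix (Fin g ⊕ Fin g) (Fin g ⊕ Fin g) (ZMod N)) i j =
        integralAdeleResidue N ⟨_, h⟩)
    (hΔ : ∀ x : Δ, ∃ k : principalLevelSubgroup δ 1, (k : gspFinAdelic δ) ∈ principalLevelSubgroup δ N₀ ∧ red k = x)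
    (hop : ∀ (k : principalLevelSubgroup δ 1) (hk : red k ∈ Δ),
      ∃ hs : (𝓜.univ.level.twist (red k)).IsSymplecticLiftable 𝓜.univ.pol δ,
        (act ⟨red k, hk⟩).inv = (haveI := 𝓜.isLocallyNoetherian
          𝓜.classifyingMap 𝓜.M ({ 𝓜.univ with level := 𝓜.univ.level.twist (red k), symplectic := hs } :
            PolarizedAbelianSchemeWithLevel g N δ 𝓜.M.left)))
    {Q : SchemeOver ℚ} (p : 𝓜.M ⟶ Q) (ρ : ActionOver p.left Δ)
    (hρ : ∀ x : Δ, (ρ.aut x).hom = (act x).hom.left) [IsAffineHom p.left] :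
    ∀ U : Q.left.Opens, IsAffineOpen U → ∀ x : Δ, x ≠ 1 →
      Ideal.span (Set.range fun b : Γ(𝓜.M.left, p.left ⁻¹ᵁ U) ↦ ρ.act x U b - b) = ⊤ :=
  ρ.free_of_forall_comp_aut_ne fun _ _ _ t x hx => by
    rw [hρ x]
    exact 𝓜.levelKernel_action_comp_ne hδ hg hd hN₀ red Δ act hred hΔ hop t x hx

/-- **THE LEVEL-DESCENT QUOTIENT MAP IS FINITE ÉTALE SURJECTIVE** ([MumfordFogartyKirwan1994] Lemma 7.11 (p. 140):
«`A_{g,d,nk} → A_{g,d,n}` is a finite étale Galois covering»; [Deligne1971TravauxShimura] 4.16).  With the data of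
`levelGroupQuotient_free`, if moreover `p.left` is FINITE and a GEOMETRIC QUOTIENT of `M` by `ρ` (Mumford's (1), (2) — the
clauses of ★ `exists_levelGroupQuotient_action`), then `p.left` is étale and surjective: a free affine geometric quotient
by a finite group is an étale torsor (★ `IsGeometricQuotient.etale_of_free`, SGA 1 V Prop. 2.6), surjective by (1).  Flatness
follows (Mathlib: étale ⇒ smooth ⇒ flat), so `T ×_Q M → T` is an fpqc cover for every `T → Q`.
[cite: MumfordFogartyKirwan1994, Ch. 7 §3 Lemma 7.11 (p. 140)] [cite: SGA1, Exp. V Prop. 2.6, Cor. 2.4]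
[cite: Deligne1971TravauxShimura, 4.16 p. 150] -/
theorem etale_levelGroupQuotient [LocallyOfFiniteType 𝓜.M.hom] (hδ : IsPolarizationType δ) (hg : 0 < g)
    {N₀ d : ℕ} [NeZero N₀] (hd : N = N₀ * d) (hN₀ : 3 ≤ N₀)
    (red : principalLevelSubgroup δ 1 →* GL (Fin g ⊕ Fin g) (ZMod N))
    (Δ : Subgroup (GL (Fin g ⊕ Fin g) (ZMod N))) (act : Δ →* Aut 𝓜.M)
    (hred : ∀ (k : principalLevelSubgroup δ 1) (i j : Fin g ⊕ Fin g)
      (h : (((k : gspFinAdelic δ) : GL (Fin g ⊕ Fin g) finAdeleQ) :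
        Matrix (Fin g ⊕ Fin g) (Fin g ⊕ Fin g) finAdeleQ) i j ∈ FiniteAdeleRing.integralAdeles (𝓞 ℚ) ℚ),
      ((red k : GL (Fin g ⊕ Fin g) (ZMod N)) : Matrix (Fin g ⊕ Fin g) (Fin g ⊕ Fin g) (ZMod N)) i j =
        integralAdeleResidue N ⟨_, h⟩)
    (hΔ : ∀ x : Δ, ∃ k : principalLevelSubgroup δ 1, (k : gspFinAdelic δ) ∈ principalLevelSubgroup δ N₀ ∧ red k = x)
    (hop : ∀ (k : principalLevelSubgroup δ 1) (hk : red k ∈ Δ),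
      ∃ hs : (𝓜.univ.level.twist (red k)).IsSymplecticLiftable 𝓜.univ.pol δ,
        (act ⟨red k, hk⟩).inv = (haveI := 𝓜.isLocallyNoetherian
          𝓜.classifyingMap 𝓜.M ({ 𝓜.univ with level := 𝓜.univ.level.twist (red k), symplectic := hs } :
            PolarizedAbelianSchemeWithLevel g N δ 𝓜.M.left)))
    {Q : SchemeOver ℚ} (p : 𝓜.M ⟶ Q) (ρ : ActionOver p.left Δ)
    (hρ : ∀ x : Δ, (ρ.aut x).hom = (act x).hom.left) (hq : ρ.IsGeometricQuotient p.left) [IsFinite p.left] :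
    Etale p.left ∧ Surjective p.left := by
  classical
  haveI : Fintype Δ := Fintype.ofFinite _
  exact ⟨hq.etale_of_free (𝓜.levelGroupQuotient_free hδ hg hd hN₀ red Δ act hred hΔ hop p ρ hρ),
    ⟨hq.surjective⟩⟩

/-- **THE LEVEL-DESCENDED CARRIER IS SMOOTH OVER `ℚ`** ([MumfordFogartyKirwan1994] Ch. 7 §3, remark after Thm. 7.9 (p. 139):
`A_{g,d,n} = A_{g,d,nk}/Γ` «exists» with the properties of Thm. 7.9, via Lemma 7.11; smoothness descends along the finite
étale surjection `A_{g,d,nk} → A_{g,d,n}` by [Grothendieck1967] IV 17.7.7).  With the data of `etale_levelGroupQuotient`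
and `Q` locally of finite type over `ℚ` (a clause of ★ `exists_levelGroupQuotient_action`): if `M → Spec ℚ` is smooth then
`Q → Spec ℚ` is smooth — `p.left` is flat (étale) and surjective with `p.left ≫ Q.hom = M.hom` smooth, `Q.hom` is locally
of finite presentation (finite type over the Noetherian `Spec ℚ`), and ★
`Morphisms.smooth_of_flat_surjective_of_smooth_comp_of_hom_spec` applies over the characteristic-`0` field `ℚ`.  This is
the clause `Smooth 𝓠.M.hom` of ★ `lan2013_siegelFineModuliScheme` for the level-descended carrier `𝓠 = ⟨Q, _, X_Q, classify⟩`.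
[cite: MumfordFogartyKirwan1994, Ch. 7 §3, remark after Theorem 7.9 (p. 139) and Lemma 7.11 (p. 140)]
[cite: Grothendieck1967, Prop. 17.7.7] -/
theorem smooth_levelGroupQuotient_hom [LocallyOfFiniteType 𝓜.M.hom] (hδ : IsPolarizationType δ) (hg : 0 < g)
    {N₀ d : ℕ} [NeZero N₀] (hd : N = N₀ * d) (hN₀ : 3 ≤ N₀)
    (red : principalLevelSubgroup δ 1 →* GL (Fin g ⊕ Fin g) (ZMod N))
    (Δ : Subgroup (GL (Fin g ⊕ Fin g) (ZMod N))) (act : Δ →* Aut 𝓜.M)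
    (hred : ∀ (k : principalLevelSubgroup δ 1) (i j : Fin g ⊕ Fin g)
      (h : (((k : gspFinAdelic δ) : GL (Fin g ⊕ Fin g) finAdeleQ) :
        Matrix (Fin g ⊕ Fin g) (Fin g ⊕ Fin g) finAdeleQ) i j ∈ FiniteAdeleRing.integralAdeles (𝓞 ℚ) ℚ),
      ((red k : GL (Fin g ⊕ Fin g) (ZMod N)) : Matrix (Fin g ⊕ Fin g) (Fin g ⊕ Fin g) (ZMod N)) i j =
        integralAdeleResidue N ⟨_, h⟩)
    (hΔ : ∀ x : Δ, ∃ k : principalLevelSubgroup δ 1, (k : gspFinAdelic δ) ∈ principalLevelSubgroup δ N₀ ∧ red k = x)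
    (hop : ∀ (k : principalLevelSubgroup δ 1) (hk : red k ∈ Δ),
      ∃ hs : (𝓜.univ.level.twist (red k)).IsSymplecticLiftable 𝓜.univ.pol δ,
        (act ⟨red k, hk⟩).inv = (haveI := 𝓜.isLocallyNoetherian
          𝓜.classifyingMap 𝓜.M ({ 𝓜.univ with level := 𝓜.univ.level.twist (red k), symplectic := hs } :
            PolarizedAbelianSchemeWithLevel g N δ 𝓜.M.left)))
    {Q : SchemeOver ℚ} (p : 𝓜.M ⟶ Q) (ρ : ActionOver p.left Δ)
    (hρ : ∀ x : Δ, (ρ.aut x).hom = (act x).hom.left) (hq : ρ.IsGeometricQuotient p.left) [IsFinite p.left]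
    [LocallyOfFiniteType Q.hom] (hsm : Smooth 𝓜.M.hom) : Smooth Q.hom := by
  obtain ⟨hét, hsurj⟩ := 𝓜.etale_levelGroupQuotient hδ hg hd hN₀ red Δ act hred hΔ hop p ρ hρ hq
  haveI := hét
  haveI := hsurj
  haveI := hsm
  haveI : LocallyOfFinitePresentation Q.hom :=
    LocallyOfFinitePresentation.iff_locallyOfFiniteType.mpr inferInstance
  exact Morphisms.smooth_of_flat_surjective_of_smooth_comp_of_hom_spec p.left Q.hom 𝓜.M.hom (Over.w p) (𝟙 _)

end SiegelFineModuliScheme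

end Literature.AlgebraicGeometry.ModuliOfAbelianVarieties

end
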